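import Mathlib.Data.Matrix.Basic
import Mathlib.Data.Matrix.Mul
import Mathlib.LinearAlgebra.Matrix.Trace
import Mathlib.Data.ZMod.Basic
import Mathlib.GroupTheory.Perm.Fin
import HarnessLib

/-!
# The subgroup `S₅(b) ⊂ S₆ ≅ Sp₄(𝔽₂)` as `4 × 4` matrices over `𝔽₂` (Boxer–Calegari–Gee–Pilloni 2025, §8.1)

Topic `Literature/NumberTheory/DiophantineGeometry`.  Vocabulary for the residual image conditions
at `2` in Boxer–Calegari–Gee–Pilloni, *Modularity theorems for abelian surfaces* (arXiv:2502.20645):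
Thm. 8.3.2 (1)–(2) "`A₅(b) ⊆ ρ̄_{A,2}(G_ℚ) ⊆ S₅(b)`, complex conjugation of order `2` in `A₅(b)`" and
Lemma 9.4.2 (2)(d) "`ρ̄_{B,2}` has image `S₅(b)` and complex conjugation has class `(**)(**)`", vendored in
`BcgpResiduallyA5bModular.lean` and `BcgpSwitchingSurface.lean` (this directory).

## The source (loc. cit. §8.1, following [BPVY])

For the Jacobian `A` of a genus-2 curve `y² = ∏_{i=1}^{6} (x - r_i)` over a field of characteristic
`≠ 2`, the `2`-torsion `A[2]` is spanned by the classes `r_i - r_j` of differences of Weierstrass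
points, and `A[2] ≅ U⁰/L` where `U = 𝔽₂⁶` with `S₆` permuting the coordinates (the natural permutation
representation), `U⁰ ⊂ U` is the sum-zero hyperplane and `L` the line spanned by `(1,…,1)`; the Weil
pairing is induced by `Σ xᵢyᵢ`.  This fixes `ι : S₆ ≅ Sp₄(𝔽₂) = GSp₄(𝔽₂)` (made explicit in Lemma
8.1.2), and "there are two conjugacy classes of subgroups `S₅ ⊂ S₆`, `S₅(a)` and `S₅(b)`, where `S₅(b)`
is the subgroup which has a fixed point …, that is, `S₅(b)` is the standard copy of `S₅` in `S₆` (and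
`A₅(b)` denotes the copy of `A₅` in `S₅(b)`).  It follows that `X` has a rational Weierstrass point if
and only if `ρ̄_{A,2}` factors through a conjugate of `S₅(b)`."

## What is here

`s5bMatrix σ ∈ M₄(𝔽₂)` for `σ ∈ S₅ = Perm (Fin 5)`: the matrix of `σ`, viewed in `S₅(b) = Stab(6) ⊂ S₆`
(letters `0,…,4` and the fixed letter `5`), acting on `U⁰/L` in the basis
`u_i = [δ_i + δ₅]`, `i = 0,…,3` (so that `[δ₄ + δ₅] = u₀ + u₁ + u₂ + u₃`).  Since `σ` fixes `5`,
`σ · (δ_j + δ₅) = δ_{σ j} + δ₅`, whence the `j`-th column of `s5bMatrix σ` is `u_{σ j}` if `σ j ≤ 3`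
and `(1,1,1,1)ᵀ` if `σ j = 4`:

  `(s5bMatrix σ) i j = 1` iff `σ j = i` or `σ j = 4`, else `0`.

Equivalently: `U⁰/L` restricted to `S₅(b)` is `𝔽₂⁵/⟨(1,…,1)⟩`, the `5`-point permutation module
modulo its trivial line (the `4`-dimensional module `V` of loc. cit., Brauer character `χ(1) = 4`,
`χ(5-cycle) = -1`, `χ(3-cycle) = 1`; Lemma 8.1.2: `V ⊗ 𝔽̄₂` is the unique `4`-dimensional irreducible
`𝔽̄₂[A₅]`-module).  Thus a Galois image "conjugate to a subgroup of `S₅(b)`" is, in a suitable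
`𝔽₂`-frame of `A[2]`, a set of matrices `s5bMatrix σ`; `A₅(b)` corresponds to `σ` even
(`Equiv.Perm.sign σ = 1`) and the class `(**)(**)` of `S₆` met inside `S₅(b)` to `σ.cycleType = {2, 2}`.

API (all proved, by computation): the entry formula `s5bMatrix_apply`, `s5bMatrix_one`, and the
traces of a transposition, a `3`-cycle and a `5`-cycle (`0, 1, 1 = -1` in `𝔽₂`, matching the printed
Brauer character of `V`).  Multiplicativity `s5bMatrix (σ * τ) = s5bMatrix σ * s5bMatrix τ` (it is the
matrix of a representation) is not needed downstream and is not proved here; nor is the symplectic form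
(`⟨u_i, u_j⟩ = 1 + δ_{ij}`) or the comparison with the explicit `ι` of Lemma 8.1.3 (any two symplectic
identifications differ by an inner automorphism of `S₆`, and `S₅(a)`, `S₅(b)` are already distinguished
inside `GL₄(𝔽₂)` by the trace of their `3`-elements: `0` for the class `(***)(***)` of `S₅(a)`, `1` for
the `3`-cycles of `S₅(b)`, cf. loc. cit. proof of Lemma 9.2.2).

## References

* G. Boxer, F. Calegari, T. Gee, V. Pilloni, *Modularity theorems for abelian surfaces*
  (arXiv:2502.20645, 2025), §8.1 (the `2`-torsion of a genus-2 Jacobian; `U`, `U⁰`, `L`; `S₅(a)`,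
  `S₅(b)`, `A₅(b)`; Lemma 8.1.2, Lemma 8.1.3 — arXiv v1 numbering, in which (8.1.1) is the
  Weil-pairing equation), Thm. 8.3.2 (1)–(2), Lemma 9.4.2 (2)(d).
  [BoxerCalegariGeePilloni2025]
-/

namespace Literature.NumberTheory.DiophantineGeometry

open Matrix Equiv

/-- **`S₅(b) → M₄(𝔽₂)`** (Boxer–Calegari–Gee–Pilloni 2025, §8.1): the matrix of `σ ∈ S₅`, placed in
the point stabiliser `S₅(b) = Stab(5) ⊂ S₆ ≅ Sp₄(𝔽₂)`, acting on `U⁰/L` (`U = 𝔽₂⁶` the permutation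
module, `U⁰` the sum-zero hyperplane, `L = ⟨(1,…,1)⟩`) in the basis `u_i = [δ_i + δ₅]`, `i ≤ 3`:
entry `(i, j)` is `1` iff `σ j = i` or `σ j = 4` (the column of `u_j ↦ u_{σ j}`, with
`u₄ = u₀ + u₁ + u₂ + u₃`).  This is the `4`-dimensional module `V = 𝔽₂⁵/⟨(1,…,1)⟩` of `S₅(b)`; even `σ`
give `A₅(b)`.
[cite: BoxerCalegariGeePilloni2025, §8.1 (A[2] ≅ U⁰/L, S₅(b), A₅(b)); Lemma 8.1.2] -/
def s5bMatrix (σ : Perm (Fin 5)) : Matrix (Fin 4) (Fin 4) (ZMod 2) :=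
  Matrix.of fun i j => if σ j.castSucc = i.castSucc ∨ σ j.castSucc = Fin.last 4 then 1 else 0

/-- Entry formula of `s5bMatrix`. [folklore] -/
theorem s5bMatrix_apply (σ : Perm (Fin 5)) (i j : Fin 4) :
    s5bMatrix σ i j = if σ j.castSucc = i.castSucc ∨ σ j.castSucc = Fin.last 4 then 1 else 0 :=
  rfl

/-- The identity permutation acts by the identity matrix. [folklore] -/
theorem s5bMatrix_one : s5bMatrix 1 = 1 := by
  decide

/-- A transposition of `S₅(b)` (class `(**)` of `S₆`, a transvection of `Sp₄(𝔽₂)`) has trace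
`0 = 4 - 2 - 2` on `V` — e.g. `σ = (0 1)`. [cite: BoxerCalegariGeePilloni2025, §8.1 (Brauer character of U and V)] -/
theorem trace_s5bMatrix_swap : (s5bMatrix (Equiv.swap (0 : Fin 5) 1)).trace = 0 := by
  decide

/-- A `3`-cycle of `S₅(b)` has trace `1 = 3 - 2` on `V` (printed: `χ((1,2,3)) = 1`), e.g.
`σ = (0 1 2) = (0 2)(0 1)`; the `3`-elements of `S₅(a)` have type `(***)(***)` and trace `0`, which is
how the two classes of `S₅ ⊂ S₆` are told apart inside `GL₄(𝔽₂)`.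
[cite: BoxerCalegariGeePilloni2025, §8.1 (Brauer character of V); proof of Lemma 9.2.2] -/
theorem trace_s5bMatrix_threeCycle :
    (s5bMatrix (Equiv.swap (0 : Fin 5) 2 * Equiv.swap (0 : Fin 5) 1)).trace = 1 := by
  decide

/-- A `5`-cycle of `S₅(b)` has trace `1 = -1` on `V` (printed: `χ((1,2,3,4,5)) = -1`), e.g.
`σ = finRotate 5`. [cite: BoxerCalegariGeePilloni2025, §8.1 (Brauer character of V)] -/
theorem trace_s5bMatrix_finRotate : (s5bMatrix (finRotate 5)).trace = 1 := by
  decide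

/-- The double transposition `(0 1)(2 3)` — cycle type `{2, 2}`, the class `(**)(**)` of `S₆` inside
`S₅(b)`, prescribed for complex conjugation in Lemma 9.4.2 (2)(d) — acts by a non-identity involution.
[cite: BoxerCalegariGeePilloni2025, Lemma 9.4.2 (2)(d)] -/
theorem s5bMatrix_doubleTransposition_ne_one_and_sq :
    s5bMatrix (Equiv.swap (0 : Fin 5) 1 * Equiv.swap (2 : Fin 5) 3) ≠ 1 ∧
      s5bMatrix (Equiv.swap (0 : Fin 5) 1 * Equiv.swap (2 : Fin 5) 3) *
        s5bMatrix (Equiv.swap (0 : Fin 5) 1 * Equiv.swap (2 : Fin 5) 3) = 1 := by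
  decide

end Literature.NumberTheory.DiophantineGeometry
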